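/-
Origin: expansion seat `planner-pub-hodgecm-qw8-g11-0`, handover #30 SPLIT PART 3/3 = REPLACE tree `HodgeCM/StubTree/Qw8GysinDescent.lean` c37c4c4e (774 l.) by md5 c4873b0c5d7cab1196a5aa262a731447 (309 l.): keeps the module name + module docstring, its earlier sections moved verbatim to rows #28..#29 (Qw8GysinDescentBase, Qw8GysinDescentBox); ONE rewrite: `import Qw8g11.Qw8GysinDescentBox` -> `import HodgeCM.StubTree.Qw8GysinDescentBox` (row #29); union of the  (`HOME/pub-hodgecm-qw8-g11/lean/Qw8g11/Qw8GysinDescent.lean`, md5 c4873b0c, 309 lines);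
landed by the packager successor (mc-unitary-1-g3, gen-8 kit) in gate run 32 REPLACES the earlier landed copy of `HodgeCM/StubTree/Qw8GysinDescent.lean` (import ^import Qw8g11\.Qw8GysinDescentBox[ \t]*$→import HodgeCM.StubTree.Qw8GysinDescentBox ×1).
-/
-- HANDOVER (planner-pub-hodgecm-qw8-g11-0, unit pub-hodgecm-qw8-g11): SPLIT PART 3/3 = REPLACEMENT of the installed
-- `HodgeCM.StubTree.Qw8GysinDescent` (md5 c37c4c4e, 774 l.): §§6–7 (ll. 546–770) verbatim; §§1–5 moved to `Qw8GysinDescentBase` /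
-- `Qw8GysinDescentBox`; the header comment (old ll. 5–55, a plain comment placed before the import) is now the module docstring,
-- text unchanged; at landing rewrite `import Qw8g11.Qw8GysinDescentBox` ↦ `import HodgeCM.StubTree.Qw8GysinDescentBox` (lands
-- AFTER parts 1, 2). Importers (`Qw8GysinDescentH0`, `AxiomAudit`, `Model/…`, `PerL34/EndStateHCCM`, `Proofs/Pohlmann/DegreeZeroDescent`)
-- are unaffected: same module name, same declarations.
/-
Copyright (c) 2026. All rights reserved.
Released under Apache 2.0 license as described in the file LICENSE.
-/
import Summits.HodgeConjecture.HodgeCM.StubTree.Qw8GysinDescentBox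

/-!
# F7d `Fact_gysinDescent` — the TRACE-FREE form of the Gysin input of [QW8] Thm 2.5, and the [QW8] cone over it

(Split for the 400-line cap: §§1–3 are now `HodgeCM.StubTree.Qw8GysinDescentBase`, §§3b–5 `HodgeCM.StubTree.Qw8GysinDescentBox` —
an import chain ending here; §§6–7 below are unchanged and this docstring still describes the whole.)

Seat `pub-hodgecm-qw8-g4` (QW8 lineage gen 4).  Target path `HodgeCM/StubTree/Qw8GysinDescent.lean`.

## Why

`COR_CM_of_genericFacts` (`StubTree/Qw8Monomial.lean`) reduces COR-CM to `ModelAxioms`, N1–N4, F4, F5, F7 `Fact_gysin`,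
`Fact_dimProd`, `Fact_trTop` (+ the face realisation).  Two of these inputs speak about the TRACE `U.tr`:
F7 (ii) (`p_{Y*}(p_Y^* e ∪ p_{Y'}^* ω) = (∫ ω) • e`) and `Fact_trTop` (`∫` bijective on `H^{2 dim X}(X)`); and every toy
universe of the package has `tr := 0` (`Model/Toy/Model.lean`), so that input list is not simultaneously witnessable in
a toy (referee A r16 G1 (ii); `Model/Toy/ToyFFacts.lean: not_fact_weightDual`; `Fact_trTop` is even FALSE in every
exterior toy, `H^4(pt⁺) = ⋀⁴ 0 = 0`).  The proofs, however, use the trace only through ONE consequence of F7 ∧ `∫ ≠ 0`: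

  **F7d (descent along boxing with a top class).**  For a block pair `p_Y : P → Y`, `p_{Y'} : P → Y'`
  (`P = Y × Y'`, `d = dim Y'`) and a nonzero rational top-degree class `ω ∈ H^{2d}(Y', ℚ)`:
  (a) `e ↦ p_Y^* e ∪ p_{Y'}^* ω : H^k(Y, ℚ) → H^{k+2d}(P, ℚ)` is injective;
  (b) if `p_Y^* e ∪ p_{Y'}^* ω` is algebraic on `P` (codimension `p + d`) then `e` is algebraic on `Y` (codimension `p`).

In print this is the one-line corollary `e = (∫_{Y'} ω)⁻¹ · p_{Y*}(p_Y^* e ∪ p_{Y'}^* ω)` of the projection formula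
for the Gysin morphism [Voisin I §7.3.2, PDF p.150–151; Fulton, *Intersection Theory* Ex. 8.1.7 / Prop. 8.3 (c), PDF
p.128, 132–133], of `∫_{Y'} : H^{2d}(Y', ℚ) ≅ ℚ` for the connected projective `Y'` [Voisin I Thm 5.30 + Rem 5.31, PDF
p.115; proof of Lemma 7.28, p.150 L9], and of "push-forward preserves algebraic classes" [Fulton §19.1, Lemma 19.1.2,
PDF p.356] — exactly the sources of F7 and `Fact_trTop`; the implication is KERNEL-CHECKED here:
`gysinDescent_of_gysin : Fact_gysin → Fact_trTopCM → Fact_gysinDescent` (`Fact_trTopCM` of `Qw8Monomial` = injectivity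
of `∫` on the top degree of CM products, the part of `Fact_trTop` that is used).  F7d mentions neither `tr` nor a Gysin
map, and it HOLDS in the exterior toy model `toyModel` (`Model/Toy/ToyGysinDescent.lean`, this seat:
`HodgeCM.Toy.fact_gysinDescent`, and `descentFacts_consistent` = ONE model of the whole residual input list below).

## What is proved (all proofs complete; axioms = propext, Classical.choice, Quot.sound)

* `Fact_gysinDescent` (F7d) and `gysinDescent_of_gysin` (F7 ∧ ∫-injective-on-CM-top ⇒ F7d);
* generic base change: `mem_baseChange_of_baseChange_map_mem` (flat descent of membership along `ℚ → ℂ`),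
  `baseChange_injective`;
* `exists_top_generator` — `H^{2 dim A′}(A′, ℚ)` is a LINE with a generator `ω₀`, every complex top class is `c ⊗ ω₀`
  (THEOREM of `ModelAxioms` + N1 + `Fact_dimProd`: `dim_ℂ H^{K+1} = C(dim H¹, K+1)`);
* **half of F7d (a) is a THEOREM** of `ModelAxioms` + N1 + F5 + `Fact_dimProd` (§3b): `boxC_fmono_ne_zero`,
  `exists_top_eq_smul_fmono` (every top class is `c · fmono q`), `pullC_top_ne_zero` (`p_{Y'}^*` injective on the top
  degree), `boxC_ne_zero_succ` ((a)_ℂ in every POSITIVE degree: weight-space decomposition of `x`, `x_χ ∪ ω` lands in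
  the weight space `χ ++ χ_top` of `P`, which are independent (M22), and `fmono ∪ fmono = ± fmono ≠ 0` by N1);
  degree `0` needs a unit/Künneth statement the `Universe` signature does not have (it is supplied by the toy proof);
* the complexified forms `boxC_eq_zero` (a)_ℂ and `mem_algC_of_boxC_mem` (b)_ℂ for arbitrary nonzero COMPLEX top `ω`;
* the [QW8] chain re-run on F7d: `box_ne_zero_of_descent`, `exists_partner_mono'` (trace-free partner: the
  complementary eigen-monomial, products nonzero by `fmono_ne_zero`), `qw8ExtProdPos_of_descent`,
  `qw8DualPushPullPos_of_descent`, `qw8MilneZero_of_descent`, `qw8Sufficiency_of_descentFacts`,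
  `qw8Milne_of_descentFacts`, `Assembly.COR_CM_of_descentFacts (U) (M) (hR) (hN1) (hN2) (hN3) (hN4) (h4) (h5) (h7d) (hd)`;
* `Assembly.COR_CM_of_descentFacts'` — the same from the verbatim F7 + `Fact_trTop` (so nothing is lost).

Residual inputs of the [QW8] side after this file: `ModelAxioms`, N1–N4, F4 `Fact_cupAlg`, F5 `Fact_cupAssoc`,
F7d `Fact_gysinDescent`, `Fact_dimProd` — none mentions the trace.
-/

noncomputable section

open scoped TensorProduct NumberField Classical

namespace HodgeCM

open Literature.AlgebraicGeometry.Motives (CMType)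
open HodgeCM.Pohlmann

namespace Universe

variable {U : Universe}

/-! ## 6. [QW8] Thm 2.5 steps (ii), (iii)+(v) in positive degree and the degree-0 residue, from F7d -/

/-- **Step (ii) in positive degree** from `ModelAxioms`, N1, F4, F5, F7d, `Fact_dimProd`. -/
theorem qw8ExtProdPos_of_descent (M : U.ModelAxioms) (hN1 : U.Fact_cupExterior) (h4 : U.Fact_cupAlg)
    (h5 : U.Fact_cupAssoc) (h7d : U.Fact_gysinDescent) (hd : U.Fact_dimProd) : U.Qw8ExtProdPos := by
  intro F _ _ v w hv hw hvp hwp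
  by_cases hSw : w.S = fun _ => Finset.univ
  · refine ⟨v, hv, hvp, ?_⟩
    rw [show w.achar = lefChar w.Θ w.S from rfl, hSw, lefChar_univ_eq_zero, add_zero]
  obtain ⟨n, Θ, p, S, x, hx0, hxw⟩ := v
  obtain ⟨m, Θ', q, S', y, hy0, hyw⟩ := w
  change x ∈ U.algC (U.cmProd F Θ) p at hv
  change y ∈ U.algC (U.cmProd F Θ') q at hw
  change 0 < p at hvp
  change 0 < q at hwp
  change ¬(S' = fun _ => Finset.univ) at hSw
  let Ξ : Fin (n + 1 + (m + 1)) → CMType F := Fin.append Θ Θ'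
  have hA : blkA Ξ = Θ := blkA_append Θ Θ'
  have hB : blkB Ξ = Θ' := blkB_append Θ Θ'
  obtain ⟨x₂, h0x, hwx, hax⟩ := U.transport_wvec hA.symm p S x
  obtain ⟨y₂, h0y, hwy, hay⟩ := U.transport_wvec hB.symm q S' y
  obtain ⟨pA, pB, hP⟩ := U.blockPair_exists M.pull_id M.pull_comp M.lift F n m Ξ
  have hdeg : 2 * p + 2 * q = 2 * (p + q) := by omega
  obtain ⟨hq, y', -, -, hyy'⟩ := U.weightDual_of_descent (blkB Ξ) M hN1 h5 hd q S' y₂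
    (fun h => hy0 (h0y.mpr h)) (hwy.mp hyw) hwp hSw
  have hij : 2 * q + 2 * (U.dim (U.cmProd F (blkB Ξ)) - q) = 2 * U.dim (U.cmProd F (blkB Ξ)) := by omega
  have hz0 : U.cupC (U.cmProd F Ξ) (2 * p) (2 * q) (U.pullC pA (2 * p) x₂) (U.pullC pB (2 * q) y₂) ≠ 0 :=
    U.box_ne_zero_of_descent Ξ M hN1 h5 hd h7d hP (fun h => hx0 (h0x.mpr h)) y₂ y' hij hyy'
  have hzw := U.isWeightVector_box' Ξ M hN1 hP (by omega) (by omega) (hwx.mp hxw) (hwy.mp hyw)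
  refine ⟨⟨n + 1 + m, Ξ, p + q, (Fin.append S S' :), U.castC _ hdeg
      (U.cupC (U.cmProd F Ξ) (2 * p) (2 * q) (U.pullC pA (2 * p) x₂) (U.pullC pB (2 * q) y₂)),
      fun h => hz0 ((LinearEquiv.map_eq_zero_iff _).mp h), U.isWeightVector_castC F Ξ _ hdeg hzw⟩, ?_, ?_, ?_⟩
  · exact U.cupC_mem_algC h4 _ p q (U.pullC_mem_algC M.pull_alg pA p (hax.mp hv))
      (U.pullC_mem_algC M.pull_alg pB q (hay.mp hw)) hdeg
  · change 0 < p + q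
    omega
  · show lefChar Ξ (Fin.append S S' :) = lefChar Θ S + lefChar Θ' S'
    rw [lefChar_append, lefChar_congr hA, lefChar_congr hB]

/-- **Steps (iii)+(v) in positive degree** from `ModelAxioms`, N1, F4, F5, F7d, `Fact_dimProd`: the partner `w'`
is the complementary monomial (no normalisation `∫ w' ∪ W = 1` is needed or possible), `Z := p_Y^* e ∪ p_{Y'}^* w'`,
and (v) is (b)_ℂ with the nonzero top class `ω = w' ∪ W`. -/
theorem qw8DualPushPullPos_of_descent (M : U.ModelAxioms) (hN1 : U.Fact_cupExterior) (h4 : U.Fact_cupAlg)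
    (h5 : U.Fact_cupAssoc) (h7d : U.Fact_gysinDescent) (hd : U.Fact_dimProd) : U.Qw8DualPushPullPos := by
  intro F _ _ e W hep hWp hW
  by_cases hSW : W.S = fun _ => Finset.univ
  · refine ⟨e, ?_, id⟩
    rw [show W.achar = lefChar W.Θ W.S from rfl, hSW, lefChar_univ_eq_zero, sub_zero]
  obtain ⟨n, Θ, p, S, x, hx0, hxw⟩ := e
  obtain ⟨m, Θ', q, S', w, hw0, hww⟩ := W
  change w ∈ U.algC (U.cmProd F Θ') q at hW
  change 0 < p at hep
  change 0 < q at hWp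
  change ¬(S' = fun _ => Finset.univ) at hSW
  let Ξ : Fin (n + 1 + (m + 1)) → CMType F := Fin.append Θ Θ'
  have hA : blkA Ξ = Θ := blkA_append Θ Θ'
  have hB : blkB Ξ = Θ' := blkB_append Θ Θ'
  obtain ⟨x₂, h0x, hwx, hax⟩ := U.transport_wvec hA.symm p S x
  obtain ⟨w₂, h0w, hww₂, haw⟩ := U.transport_wvec hB.symm q S' w
  obtain ⟨pA, pB, hP⟩ := U.blockPair_exists M.pull_id M.pull_comp M.lift F n m Ξ
  -- (iii) the partner `w'` of `W` on the second block: the complementary monomial, `w' ∪ W ≠ 0`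
  obtain ⟨hq, w', hw', hww', -⟩ := U.weightDual_of_descent (blkB Ξ) M hN1 h5 hd q S' w₂
    (fun h => hw0 (h0w.mpr h)) (hww₂.mp hww) hWp hSW
  have h6' : 2 * (U.dim (U.cmProd F (blkB Ξ)) - q) + 2 * q = 2 * U.dim (U.cmProd F (blkB Ξ)) := by omega
  -- `Z := p_Y^* e ∪ p_{Y'}^* w'`
  have hdeg : 2 * p + 2 * (U.dim (U.cmProd F (blkB Ξ)) - q) = 2 * (p + (U.dim (U.cmProd F (blkB Ξ)) - q)) := by
    omega
  have hZ0 : U.cupC (U.cmProd F Ξ) (2 * p) (2 * (U.dim (U.cmProd F (blkB Ξ)) - q)) (U.pullC pA (2 * p) x₂)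
      (U.pullC pB (2 * (U.dim (U.cmProd F (blkB Ξ)) - q)) w') ≠ 0 :=
    U.box_ne_zero_of_descent Ξ M hN1 h5 hd h7d hP (fun h => hx0 (h0x.mpr h)) w' w₂ h6' hww'
  have hZw := U.isWeightVector_box' Ξ M hN1 hP (by omega) (by omega) (hwx.mp hxw) hw'
  refine ⟨⟨n + 1 + m, Ξ, p + (U.dim (U.cmProd F (blkB Ξ)) - q), (Fin.append S (fun i => (S' i)ᶜ) :), U.castC _ hdeg
      (U.cupC (U.cmProd F Ξ) (2 * p) (2 * (U.dim (U.cmProd F (blkB Ξ)) - q)) (U.pullC pA (2 * p) x₂)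
        (U.pullC pB (2 * (U.dim (U.cmProd F (blkB Ξ)) - q)) w')),
      fun h => hZ0 ((LinearEquiv.map_eq_zero_iff _).mp h), U.isWeightVector_castC F Ξ _ hdeg hZw⟩, ?_, ?_⟩
  · -- `a(Z) = a(e) - a(W)`
    show lefChar Ξ (Fin.append S (fun i => (S' i)ᶜ) :) = lefChar Θ S - lefChar Θ' S'
    rw [lefChar_append, lefChar_congr hA, lefChar_congr hB,
      eq_neg_of_add_eq_zero_right (lefChar_add_lefChar_compl Θ' S'), sub_eq_add_neg]
  · -- (v) `Z` algebraic ⇒ `e` algebraic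
    intro hZalg
    change U.castC _ hdeg (U.cupC (U.cmProd F Ξ) (2 * p) (2 * (U.dim (U.cmProd F (blkB Ξ)) - q))
      (U.pullC pA (2 * p) x₂) (U.pullC pB (2 * (U.dim (U.cmProd F (blkB Ξ)) - q)) w')) ∈
        U.algC (U.cmProd F Ξ) (p + (U.dim (U.cmProd F (blkB Ξ)) - q)) at hZalg
    show x ∈ U.algC (U.cmProd F Θ) p
    refine hax.mpr ?_
    have hpB : U.pullC pB (2 * q) w₂ ∈ U.algC (U.cmProd F Ξ) q := U.pullC_mem_algC M.pull_alg pB q (haw.mp hW)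
    have hdeg1 : 2 * (p + (U.dim (U.cmProd F (blkB Ξ)) - q)) + 2 * q =
        2 * (p + (U.dim (U.cmProd F (blkB Ξ)) - q) + q) := by omega
    have hA1 := U.cupC_mem_algC h4 _ (p + (U.dim (U.cmProd F (blkB Ξ)) - q)) q hZalg hpB hdeg1
    have hidx : p + (U.dim (U.cmProd F (blkB Ξ)) - q) + q = p + U.dim (U.cmProd F (blkB Ξ)) := by omega
    have hA2 := (U.castC_mem_algC_iff (U.cmProd F Ξ) hidx (by omega) _).mpr hA1
    obtain ⟨ω, hω⟩ : ∃ ω, ω = U.castC _ h6' (U.cupC _ (2 * (U.dim (U.cmProd F (blkB Ξ)) - q)) (2 * q) w' w₂) :=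
      ⟨_, rfl⟩
    have hωback : U.cupC _ (2 * (U.dim (U.cmProd F (blkB Ξ)) - q)) (2 * q) w' w₂ = U.castC _ h6'.symm ω := by
      rw [hω, castC_castC, castC_self]
    have hω0 : ω ≠ 0 := by rw [hω]; exact (LinearEquiv.map_ne_zero_iff _).mpr hww'
    have calc1 : U.cupC (U.cmProd F Ξ) (2 * (p + (U.dim (U.cmProd F (blkB Ξ)) - q))) (2 * q) (U.castC _ hdeg
        (U.cupC (U.cmProd F Ξ) (2 * p) (2 * (U.dim (U.cmProd F (blkB Ξ)) - q)) (U.pullC pA (2 * p) x₂)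
          (U.pullC pB (2 * (U.dim (U.cmProd F (blkB Ξ)) - q)) w')))
        (U.pullC pB (2 * q) w₂) =
        U.castC _ (by omega : 2 * p + 2 * U.dim (U.cmProd F (blkB Ξ)) = 2 * (p + (U.dim (U.cmProd F (blkB Ξ)) - q)) + 2 * q)
          (U.cupC (U.cmProd F Ξ) (2 * p) (2 * U.dim (U.cmProd F (blkB Ξ))) (U.pullC pA (2 * p) x₂)
            (U.pullC pB (2 * U.dim (U.cmProd F (blkB Ξ))) ω)) := by
      rw [cupC_castC_left, cupC_assoc U h5, ← pullC_cupC U M.pull_cup, hωback, pullC_castC, cupC_castC_right]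
      simp only [castC_castC]
    rw [calc1] at hA2
    simp only [castC_castC] at hA2
    exact U.mem_algC_of_boxC_mem Ξ M hN1 hd h7d hP hω0 (by omega) hA2

/-- **`Qw8MilneZero` from `ModelAxioms`, N1, N3, F7d, `Fact_dimProd` and `Qw8MilnePos`**: for `0 ≠ x ∈ H⁰(Y) ⊗ ℂ`
take a second block `Y' = A_{Θ 0}` and its top eigen-monomial `ω ≠ 0`; `Z := p_Y^* x ∪ p_{Y'}^* ω ≠ 0` ((a)_ℂ) has
character `0` and positive degree, so is algebraic (`Qw8MilnePos`), and (b)_ℂ descends algebraicity to `x`. -/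
theorem qw8MilneZero_of_descent (M : U.ModelAxioms) (hN1 : U.Fact_cupExterior) (hN3 : U.Fact_pull_H0)
    (hd : U.Fact_dimProd) (h7d : U.Fact_gysinDescent) (hpos : U.Qw8MilnePos) : U.Qw8MilneZero := by
  intro F hG h6 z hzp
  obtain ⟨n, Θ, p, S, x, hx0, hxw⟩ := z
  change p = 0 at hzp
  subst hzp
  change x ∈ U.algC (U.cmProd F Θ) 0
  let Θ' : Fin (0 + 1) → CMType F := fun _ => Θ 0
  let Ξ : Fin (n + 1 + (0 + 1)) → CMType F := Fin.append Θ Θ'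
  have hA : blkA Ξ = Θ := blkA_append Θ Θ'
  obtain ⟨x₂, h0x, -, hax⟩ := U.transport_wvec hA.symm 0 S x
  have hx₂0 : x₂ ≠ 0 := fun h => hx0 (h0x.mpr h)
  obtain ⟨pA, pB, hP⟩ := U.blockPair_exists M.pull_id M.pull_comp M.lift F n 0 Ξ
  -- the top eigen-monomial `ω ≠ 0` of `Y'`
  obtain ⟨β, -, hβ⟩ := exists_integral_injective_eval F
  choose xB hxB _hx0 hsp using fun i => exists_eigenbasis M F (blkB Ξ i) β hβ
  have h2d : 2 * U.dim (U.cmProd F (blkB Ξ)) = Module.finrank ℚ F := by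
    have h := U.two_mul_dim_cmProd_of_dimProd M hd F (blkB Ξ)
    simpa using h
  have hdpos : 0 < U.dim (U.cmProd F (blkB Ξ)) := by
    have hF : 0 < Module.finrank ℚ F := Module.finrank_pos
    omega
  obtain ⟨K, hK⟩ : ∃ K, 2 * U.dim (U.cmProd F (blkB Ξ)) = K + 1 := ⟨2 * U.dim (U.cmProd F (blkB Ξ)) - 1, by omega⟩
  have hcard : Fintype.card (Fin (0 + 1) × ((F : Type) →+* ℂ)) = K + 1 := by
    rw [card_index]; simp only [zero_add, one_mul]; omega
  let q : Fin (K + 1) → Fin (0 + 1) × ((F : Type) →+* ℂ) := fun t => (Fintype.equivFin _).symm (finCongr hcard.symm t)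
  have hqb : Function.Bijective q := (Fintype.equivFin _).symm.bijective.comp (finCongr hcard.symm).bijective
  let ω : U.CohC (U.cmProd F (blkB Ξ)) (2 * U.dim (U.cmProd F (blkB Ξ))) := U.castC _ hK.symm (U.fmono xB K q)
  have hω0 : ω ≠ 0 := (LinearEquiv.map_ne_zero_iff _).mpr (U.fmono_ne_zero xB M hN1 hxB hsp hqb.1)
  have hωw : U.IsWeightVector F (blkB Ξ) (fun _ => Finset.univ) (2 * U.dim (U.cmProd F (blkB Ξ))) ω := by
    have h := isWeightVector_fmono xB M hxB K q hqb.1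
    rw [wtOf_eq_univ_of_surjective hqb.2] at h
    exact U.isWeightVector_castC F (blkB Ξ) _ hK.symm h
  -- `Z := p_Y^* x ∪ p_{Y'}^* ω ≠ 0`, of weight `((∅)_j, univ)`: character `0`, positive degree
  have hZ0 : U.cupC (U.cmProd F Ξ) (2 * 0) (2 * U.dim (U.cmProd F (blkB Ξ))) (U.pullC pA (2 * 0) x₂)
      (U.pullC pB (2 * U.dim (U.cmProd F (blkB Ξ))) ω) ≠ 0 :=
    fun h => hx₂0 (U.boxC_eq_zero Ξ M hN1 hd h7d hP hω0 h)
  have hxw0 : U.IsWeightVector F Ξ (fun _ => ∅) (2 * 0) (U.pullC pA (2 * 0) x₂) := isWeightVector_zero hN3 _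
  have hZw : U.IsWeightVector F Ξ
      (Fin.append (fun _ : Fin (n + 1) => (∅ : Finset ((F : Type) →+* ℂ))) (fun _ : Fin (0 + 1) => Finset.univ) :)
      (2 * 0 + 2 * U.dim (U.cmProd F (blkB Ξ)))
      (U.cupC (U.cmProd F Ξ) (2 * 0) (2 * U.dim (U.cmProd F (blkB Ξ))) (U.pullC pA (2 * 0) x₂)
        (U.pullC pB (2 * U.dim (U.cmProd F (blkB Ξ))) ω)) := by
    have h := U.isWeightVector_cupC_of_disjoint M.pull_cup (S := fun _ => ∅)
      (S' := (Fin.append (fun _ : Fin (n + 1) => (∅ : Finset ((F : Type) →+* ℂ)))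
        (fun _ : Fin (0 + 1) => Finset.univ) :))
      (fun _ => Finset.disjoint_empty_left _) hxw0 (U.isWeightVector_pullC_blkB Ξ M hN1 hP (by omega) hωw)
    simpa only [Finset.empty_union] using h
  have hdeg0 : 2 * 0 + 2 * U.dim (U.cmProd F (blkB Ξ)) = 2 * U.dim (U.cmProd F (blkB Ξ)) := by omega
  let Z : U.WVec F := ⟨n + 1 + 0, Ξ, U.dim (U.cmProd F (blkB Ξ)),
    (Fin.append (fun _ : Fin (n + 1) => (∅ : Finset ((F : Type) →+* ℂ))) (fun _ : Fin (0 + 1) => Finset.univ) :),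
    U.castC _ hdeg0 (U.cupC (U.cmProd F Ξ) (2 * 0) (2 * U.dim (U.cmProd F (blkB Ξ))) (U.pullC pA (2 * 0) x₂)
      (U.pullC pB (2 * U.dim (U.cmProd F (blkB Ξ))) ω)),
    fun h => hZ0 ((LinearEquiv.map_eq_zero_iff _).mp h), U.isWeightVector_castC F Ξ _ hdeg0 hZw⟩
  have hZa : Z.achar = 0 := by
    show lefChar Ξ (Fin.append (fun _ : Fin (n + 1) => (∅ : Finset ((F : Type) →+* ℂ)))
      (fun _ : Fin (0 + 1) => Finset.univ) :) = 0
    rw [lefChar_append, lefChar_univ_eq_zero, add_zero]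
    unfold lefChar
    simp
  have hZalg : Z.IsAlg := hpos F hG h6 Z hdpos hZa
  change U.castC _ hdeg0 (U.cupC (U.cmProd F Ξ) (2 * 0) (2 * U.dim (U.cmProd F (blkB Ξ))) (U.pullC pA (2 * 0) x₂)
      (U.pullC pB (2 * U.dim (U.cmProd F (blkB Ξ))) ω)) ∈ U.algC (U.cmProd F Ξ) (U.dim (U.cmProd F (blkB Ξ))) at hZalg
  -- descend: (b)_ℂ
  refine hax.mpr ?_
  have hA2 := (U.castC_mem_algC_iff (U.cmProd F Ξ) (show U.dim (U.cmProd F (blkB Ξ)) = 0 + U.dim (U.cmProd F (blkB Ξ))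
    by omega) (by omega) _).mpr hZalg
  rw [castC_castC] at hA2
  exact U.mem_algC_of_boxC_mem Ξ M hN1 hd h7d hP hω0 (by omega) hA2

/-! ## 7. Assembly -/

/-- **`Qw8Sufficiency` from the model axioms, N1–N4, F4, F5, F7d `Fact_gysinDescent` and `Fact_dimProd`** — no
trace anywhere in the inputs (no F2, F6, F7, `Fact_trTop`, N5, `Qw8MilneZero` hypothesis). -/
theorem qw8Sufficiency_of_descentFacts (M : U.ModelAxioms) (hN1 : U.Fact_cupExterior) (hN2 : U.Fact_cup_hodge)
    (hN3 : U.Fact_pull_H0) (hN4 : U.Fact_hodge_F0) (h4 : U.Fact_cupAlg) (h5 : U.Fact_cupAssoc)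
    (h7d : U.Fact_gysinDescent) (hd : U.Fact_dimProd) : U.Qw8Sufficiency :=
  have hpos := qw8MilnePos_of_facts M hN1 hN2 hN3 hN4 h4 h5
  have h0 := U.qw8MilneZero_of_descent M hN1 hN3 hd h7d hpos
  U.qw8Sufficiency_of_steps_pos (U.qw8ExtProdPos_of_descent M hN1 h4 h5 h7d hd)
    (U.qw8DualPushPullPos_of_descent M hN1 h4 h5 h7d hd) (qw8Milne_of_pos_of_zero hpos h0) h0
    (qw8FaceBridge_holds M)

/-- `Qw8Milne` (all degrees) from the model axioms, N1–N4, F4, F5, F7d and `Fact_dimProd`. -/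
theorem qw8Milne_of_descentFacts (M : U.ModelAxioms) (hN1 : U.Fact_cupExterior) (hN2 : U.Fact_cup_hodge)
    (hN3 : U.Fact_pull_H0) (hN4 : U.Fact_hodge_F0) (h4 : U.Fact_cupAlg) (h5 : U.Fact_cupAssoc)
    (h7d : U.Fact_gysinDescent) (hd : U.Fact_dimProd) : U.Qw8Milne :=
  have hpos := qw8MilnePos_of_facts M hN1 hN2 hN3 hN4 h4 h5
  qw8Milne_of_pos_of_zero hpos (U.qw8MilneZero_of_descent M hN1 hN3 hd h7d hpos)

end Universe

namespace Assembly

/-- **COR-CM from the model axioms, N1–N4, F4, F5, F7d `Fact_gysinDescent`, `Fact_dimProd` and the face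
realisation** — the [QW8] side with NO trace-dependent input (so the input list is witnessable in the exterior toy
model, whose trace is `0`). -/
theorem COR_CM_of_descentFacts (U : Universe) (M : U.ModelAxioms) (hR : U.RealisationExistsFace)
    (hN1 : U.Fact_cupExterior) (hN2 : U.Fact_cup_hodge) (hN3 : U.Fact_pull_H0) (hN4 : U.Fact_hodge_F0)
    (h4 : U.Fact_cupAlg) (h5 : U.Fact_cupAssoc) (h7d : U.Fact_gysinDescent) (hd : U.Fact_dimProd) : U.HC_CM :=
  COR_CM U M hR (U.pohlmannSpan_of_facts M hN1 hN2 hN3 hN4)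
    (U.qw8Sufficiency_of_descentFacts M hN1 hN2 hN3 hN4 h4 h5 h7d hd)

/-- The same from the VERBATIM textbook inputs F7 `Fact_gysin` + `Fact_trTop` (which imply F7d:
`gysinDescent_of_gysin_trTop`) — identical input list to `COR_CM_of_genericFacts`. -/
theorem COR_CM_of_descentFacts' (U : Universe) (M : U.ModelAxioms) (hR : U.RealisationExistsFace)
    (hN1 : U.Fact_cupExterior) (hN2 : U.Fact_cup_hodge) (hN3 : U.Fact_pull_H0) (hN4 : U.Fact_hodge_F0)
    (h4 : U.Fact_cupAlg) (h5 : U.Fact_cupAssoc) (h7 : U.Fact_gysin) (hd : U.Fact_dimProd) (ht : U.Fact_trTop) :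
    U.HC_CM :=
  COR_CM_of_descentFacts U M hR hN1 hN2 hN3 hN4 h4 h5 (Universe.gysinDescent_of_gysin_trTop h7 ht) hd

end Assembly

end HodgeCM

end
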